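import Summits.QuantumFields.YangMills.Theorems.BalabanUVNodesN22WindowedCouplingHoloOfLocalTerms
import Summits.QuantumFields.BalabanUV.T4Continuum.Spine.NE1p.DressedOutputAnalyticFaces

/-!
# BalabanUVNodes ∕ node N22 = NE9 — THE PER-TERM JOINT (coupling, field) CHARTS OF THE ANALYTIC ROAD FROM ACTIVITY-LEVEL JOINT CHARTS: the cluster expansion is analytic in
# its activities over ANY complex parameter space (S25's parametric Kotecký–Preiss engine), so activity charts on `Dt × ball(0,R) ⊆ ℂ × Ec` with (2.38) give the output
# charts of `…N22WindowedCouplingHoloOfLocalTerms` with the (1.18)-type bound — and `h9` with the record's geometric moduli on ROAD 3 («J43's twin for the analytic road»)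

WIDTH SEAT dag-n22-w1 (g4), piece C6 of its own lineage (C1 `…N22WindowedTwoConstants` → C2 `…N22KernelFadingOfStepRateTwoConstants` → C3 `…N22WindowedCouplingHoloOfJointHolo` →
C4 `…N22WindowedCouplingHoloOfLocalTerms`).  THEOREMS ONLY (no `def`, no `sorry`, standard axioms); `--kind proof --supports stmt-QuantumFields-27366 --as helper`, COUNT-NEUTRAL.
Imports C4 and the gaps cell's S25 `Spine.NE1p.DressedOutputAnalyticFaces` (`analytic_and_bounded_locE_param_torus`).  Nothing re-declared.

THE POINT.  dag-n22-c's J43 `…N22AtRecordOfKernelFadingActivityMargins` reads ACTIVITY-level coupling margins with ONE radius (parameter space `ℂ`) and gets `h9` on the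
second-difference road (ROAD 2, row `ℓ.θ₅ ≤ ℓ.ω²`).  C4 §3 gets `h9` on the ANALYTIC road (ROAD 3, `ℓ.ω` anywhere in `]ℓ.θ₅, 1[`) from per-term JOINT (coupling, field) output
charts.  THIS FILE produces those joint output charts from ACTIVITY-level joint charts — the same engine at the parameter space `ℂ × Ec`:
* §1 ★ `outputChart_of_activityCharts` — GENERIC `P`: for one-step data `S`, a domain `X`, an open `U ⊆ P` and activity charts `Hc Z : P → ℂ` (`Z ⊆ X`) holomorphic on `U` with
  the (2.38) majorant there, under Road 1's numerals: `p ↦ locE(Z ↦ Hc Z p)(X)` is holomorphic on `U`, bounded by `e·9·64·K₀(64,8)²·A·e^{−r₁ d_{k+1}(X)}`, and equals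
  `E^{(k+1)}(X; g; φ)` wherever the charts take the values `H(Z; g; φ)` (`ClusterStep.E_eq_locE`, `locE_congr`).  J43 §1 is `P = ℂ`; J30 v1.1's engine is a field chart at a
  real history; here `P` is free.
* §2 ★★ `jointCharts_of_activityJointCharts` — `P = ℂ × Ec K k`, `U = Dt × ball(0, R)`: activity-level joint charts `ℋ K k h m X Z` agreeing at `(t, ι K k X B)` with
  `H(Z; (h|h_m:=t)_{≤k}; emb(exp ρB))` ⟹ the three chart binders `h𝒢 ∕ hM𝒢 ∕ hf` of C4's `windowedCouplingHolo_localizedSum` for `𝒢 := locE ∘ ℋ`, letters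
  `(B, κ_E) := (e·9·64·K₀(64,8)²·A, r₁)`.
* §3 ★★★ `ne9_EA_objectsOfRecord₁₃_of_kernelStepRate_activityJointCharts` — AT THE RECORD: C4 §3 with its joint-chart datum PRODUCED by §2: N18's `KernelStepRateOfRecord₁₃`, the
  uniform decay, (1.21), W1-20's law, ACTIVITY-level joint charts with (2.38) on `Dt × ball(0,R)`, Road 1's numerals, the terms REAL at real data, probe readings with tails, rows
  (`κ ≤ r₁` now the rate row) ⟹ `NE9 ((objectsOfRecord₁₃ F N θ ℓ).EA 0) (Window θ.γ) ℓ.κ ℓ.moduli`; ★★★ pin face `n22At_rateCarriers_of_kernels_pin_of_kernelStepRate_activityJointCharts`.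

HONEST FRAMING (binding).  Count-neutral COMPOSITION; NO estimate of Bałaban's is proved or asserted.  Displayed with owners: the activity-level JOINT (young coupling, field) charts
with (2.38) on the complex product domain — node N10's T-row complexified jointly in a young coupling and the small field ([II] p. 12 (2.3), p. 15 «the activities are analytic
functions of (𝐔, 𝐉)», Lemma 3 (2.38) p. 20, READ on complex discs: a LOCATED reading, NOT a printed display, and NOT met by any object of record here); Road 1's numerals; node N18's
kernel step rate (NE5 NOT PRINTED for d = 4); the decay; readings ∕ tails (NODE A ∕ N09); the law (def-W1 ∕ NODE A); (1.21) (dag-n22-w3's road); reality of the terms at real data.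
N22 is NOT discharged (typed 28∕28 · discharged 5∕27 UNCHANGED — the chair's single count line is the only count); K3⁸ `SpineGivenEndpointR13SepCoPHV` OPEN and NOT claimed; NE9 is NOT
IN PRINT for d = 4; one finite 𝕋⁴ programme at fixed ε — R4 closes the CONDITIONAL rung `BalabanLadder.UV` only; NOTHING about the continuum limit, ℝ⁴, infinite volume, OS axioms,
a mass gap or the Clay problem is proved or claimed.  References (TYPES only): [I] = Bałaban, CMP 109 (1987) Thm 1 p. 259, (1.7) p. 261, (1.18) p. 263, (1.20)–(1.22) p. 264,
p. 282, (5.10) p. 293; [II] = CMP 116 (1988) (2.3) p. 12, (2.13) p. 14, p. 15, Lemma 3 (2.38) p. 20, (2.41) p. 21.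
-/

noncomputable section

open Filter Topology Set Metric
open scoped BigOperators

namespace YMDAG.N22.JointHoloLocalTerms

open Literature.MathematicalPhysics.QuantumFieldTheory.Balaban1983to89
open Literature.MathematicalPhysics.QuantumFieldTheory.Balaban1983to89.T4Continuum (T4Family ULoop)
open Literature.MathematicalPhysics.QuantumFieldTheory.Balaban1983to89.T4OutputRate (Window NE9 DecayBound)
open Literature.MathematicalPhysics.QuantumFieldTheory.Balaban1983to89.TreeLengthTorus (TPt tsys torusTreeLen torusTreeLen_nonneg)
open Literature.MathematicalPhysics.QuantumFieldTheory.Balaban1983to89.TreeLengthTorusGeometry (TTouch)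
open Literature.MathematicalPhysics.QuantumFieldTheory.Balaban1983to89.B12TreeDecay (K₀ kappa₀ K₀_pos)
open Literature.MathematicalPhysics.QuantumFieldTheory.Balaban1983to89.B12Decay510 (delta1)
open Literature.MathematicalPhysics.QuantumFieldTheory.Balaban1983to89.B12Decay510Window (K₁ K₁_nonneg)
open Literature.MathematicalPhysics.QuantumFieldTheory.Balaban1983to89.B12Decay510Torus (distCT nearT)
open Literature.MathematicalPhysics.QuantumFieldTheory.Balaban1983to89.B13Resummation (locE locE_congr)
open Literature.MathematicalPhysics.QuantumFieldTheory.Balaban1983to89.Node00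
open Literature.MathematicalPhysics.QuantumFieldTheory.Balaban1983to89.Node00.Sect2 (domSys domCount CPair)
open Literature.MathematicalPhysics.QuantumFieldTheory.Balaban1983to89.Node00.W1
open Literature.MathematicalPhysics.QuantumFieldTheory.Balaban1983to89.Node00.LocalizedSum17 (ReadingMaps Localizes17OfRecord₁₃)
open Literature.MathematicalPhysics.QuantumFieldTheory.Balaban1983to89.Node00.U3OfKernels (histPrefix objectsOfRecord₁₃)
open Literature.MathematicalPhysics.QuantumFieldTheory.Balaban1983to89.Node00.U3KernelLetters (KernelStepRateOfRecord₁₃ PolLimitsExistOfRecord₁₃)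
open YMDAG.UVSplit (N22At RateReading₁₃CoPH rateCarriersOfRecord₁₃CoPH)
open YMDAG.N22.AtKernels (n22At_rateCarriers_of_kernels_pin_of_ne9)
open Summit.QuantumFields.BalabanUV.T4Continuum.NE1p.DressedOutputAnalyticFaces (analytic_and_bounded_locE_param_torus)

open scoped Matrix.Norms.L2Operator

/-! ## §1 ACTIVITY CHARTS ⟹ OUTPUT CHART over ANY complex parameter space (the cluster expansion is analytic in its activities) -/

section Step

variable (F : T4Family) (K : ℕ) {𝔸 : Type*} {M : ℕ} {k : ℕ}

open Classical in
/-- ★ **THE (2.13) TERM IS HOLOMORPHIC IN ANY PARAMETER ITS ACTIVITIES ARE HOLOMORPHIC IN, WITH THE (1.18)-TYPE BOUND, AND TAKES THE TERM's VALUE WHERE THE CHARTS TAKE THE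
ACTIVITIES' VALUES.**  For W1's one-step data `S` at level `k`, a domain `X ∈ 𝐃_{k+1}`, an OPEN set `U` of ANY complex normed space `P` and activity charts `Hc Z : P → ℂ`
(`Z ⊆ X`) holomorphic on `U` with the (2.38) majorant `‖Hc Z p‖ ≤ A·e^{−R d_{k+1}(Z)}` there, under Road 1's numerals (`0 ≤ A`, `0 ≤ r₁`, `r₁ + 128 log 162 + 2 ≤ R`,
`A·e^{5r₁+1}·K₀(64,8)·9·64 ≤ 1`): the chart `p ↦ locE(Z ↦ Hc Z p)(X)` is holomorphic on `U`, bounded there by `e·9·64·K₀(64,8)²·A·e^{−r₁ d_{k+1}(X)}`, and EQUALS the (2.13)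
term `E^{(k+1)}(X; g; φ)` at every parameter `p` where the charts take the values `H(Z; g; φ)`, `Z ⊆ X` — S25's parametric Kotecký–Preiss engine
`analytic_and_bounded_locE_param_torus` at `P`, `ClusterStep.E_eq_locE` (`rfl`), `locE_congr`.  (J43 §1 is the case `P = ℂ`, J30 v1.1's engine the case of a field chart at a
real history; here `P` is free — §2 takes `P = ℂ × Ec`.) [folklore] -/
theorem outputChart_of_activityCharts (S : ClusterStep (F.P K) 𝔸 M k) {P : Type*} [NormedAddCommGroup P] [NormedSpace ℂ P] {U : Set P} (hU : IsOpen U)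
    {A R r₁ : ℝ} (hA : 0 ≤ A) (hr₁ : 0 ≤ r₁) (hrate : r₁ + 2 * (64 * Real.log 162) + 2 ≤ R) (hsmall : A * Real.exp (5 * r₁ + 1) * K₀ 64 8 * 9 * 64 ≤ 1)
    (X : (domSys (F.P K) M (k + 1)).Dom) (Hc : (domSys (F.P K) M (k + 1)).Dom → P → ℂ)
    (hhol : ∀ Z : (domSys (F.P K) M (k + 1)).Dom, Z.1 ⊆ X.1 → DifferentiableOn ℂ (Hc Z) U)
    (hbd : ∀ p ∈ U, ∀ Z : (domSys (F.P K) M (k + 1)).Dom, Z.1 ⊆ X.1 → ‖Hc Z p‖ ≤ A * Real.exp (-(R * (domSys (F.P K) M (k + 1)).dj Z))) :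
    DifferentiableOn ℂ (fun p => locE (TTouch (d := 4) (N := domCount (F.P K) M (k + 1))) (fun Z : (domSys (F.P K) M (k + 1)).Dom => Z.1) (fun Z => Hc Z p) X.1) U ∧
      (∀ p ∈ U, ‖locE (TTouch (d := 4) (N := domCount (F.P K) M (k + 1))) (fun Z : (domSys (F.P K) M (k + 1)).Dom => Z.1) (fun Z => Hc Z p) X.1‖ ≤
        Real.exp 1 * 9 * 64 * K₀ 64 8 ^ 2 * A * Real.exp (-(r₁ * (domSys (F.P K) M (k + 1)).dj X))) ∧
      ∀ (p : P) (g : Fin (k + 1) → ℝ) (φ : CPair (F.P K) 𝔸), (∀ Z : (domSys (F.P K) M (k + 1)).Dom, Z.1 ⊆ X.1 → Hc Z p = S.H g φ Z) →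
        locE (TTouch (d := 4) (N := domCount (F.P K) M (k + 1))) (fun Z : (domSys (F.P K) M (k + 1)).Dom => Z.1) (fun Z => Hc Z p) X.1 = S.E g φ X := by
  obtain ⟨hdiff, hbdE⟩ := analytic_and_bounded_locE_param_torus (N := domCount (F.P K) M (k + 1)) (P := P)
    (m := fun Z : (tsys 4 (domCount (F.P K) M (k + 1))).Dom => A * Real.exp (-(R * torusTreeLen Z.1))) (act := fun p Z => Hc Z p)
    (A := A) (R := R) (r₁ := r₁) X hU hA hr₁ hrate hsmall (fun Z hZ => hhol Z hZ) (fun p hp Z hZ => hbd p hp Z hZ) (fun _ _ => le_rfl)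
  refine ⟨hdiff, hbdE, fun p g φ hagree => ?_⟩
  rw [ClusterStep.E_eq_locE]
  exact locE_congr _ fun Z hZ => hagree Z hZ

end Step

/-! ## §2 THE JOINT (coupling, field) CHARTS OF `…N22WindowedCouplingHoloOfLocalTerms` FROM ACTIVITY-LEVEL JOINT CHARTS (`P = ℂ × Ec`) -/

section Tower

variable (F : T4Family) {𝔄 : Type*} [NormedRing 𝔄] [NormedAlgebra ℝ 𝔄] {V : Type*} [NormedAddCommGroup V] [NormedSpace ℝ V] {𝔸 : Type*} {M : ℕ}

open Classical in
/-- ★★ **PER-TERM JOINT (coupling, field) CHARTS WITH THE (1.18)-TYPE BOUND FROM ACTIVITY-LEVEL JOINT CHARTS WITH (2.38).**  For towers `S`, readings `emb`, a β-chart `ρ`, complexified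
probe readings `ι K k X` into complex normed spaces `Ec K k`, a coupling domain `Dt ⊆ ℂ` (open) and a field radius `R`: IF for every volume `K`, level `k`, window history `h`, young
coupling `m`, domain `X` and sub-polymer `Z ⊆ X` the ACTIVITY `H(Z; (h|h_m:=t)_{≤k}; emb(exp ρB))` is the value at `(t, ι K k X B)` (`t ∈ ]0, γ]`, `B` real) of a chart
`ℋ K k h m X Z : ℂ × Ec K k → ℂ` holomorphic on `Dt × ball(0, R)` with `‖ℋ‖ ≤ A·e^{−Ra d_{k+1}(Z)}` there (the T-row complexified JOINTLY in the young coupling and the field —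
[II] p. 12 (2.3), p. 15, Lemma 3 (2.38) p. 20, read on complex discs; DISPLAYED, not printed), under Road 1's numerals, THEN the charts
`𝒢 K k h m X := p ↦ locE(Z ↦ ℋ K k h m X Z p)(X)` are holomorphic on `Dt × ball(0, R)`, bounded there by `(e·9·64·K₀(64,8)²·A)·e^{−r₁ d_{k+1}(X)}`, and agree at
`(t, ι K k X B)` with `E^{(k+1)}(X; (h|h_m:=t)_{≤k}; emb(exp ρB))` — the three chart binders `h𝒢 ∕ hM𝒢 ∕ hf` of `JointHoloLocalTerms.windowedCouplingHolo_localizedSum` at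
`(B, κ_E) := (e·9·64·K₀(64,8)²·A, r₁)` (§1 at `P = ℂ × Ec K k`, `U = Dt × ball(0, R)`). [folklore] -/
theorem jointCharts_of_activityJointCharts (S : (K : ℕ) → ClusterTower (F.P K) 𝔸 M) (emb : ReadingMaps F 𝔄 𝔸) (ρ : V →L[ℝ] 𝔄) {γ R A Ra r₁ : ℝ}
    (hA : 0 ≤ A) (hr₁ : 0 ≤ r₁) (hrate : r₁ + 2 * (64 * Real.log 162) + 2 ≤ Ra) (hsmall : A * Real.exp (5 * r₁ + 1) * K₀ 64 8 * 9 * 64 ≤ 1)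
    (Ec : ℕ → ℕ → Type*) [∀ K k, NormedAddCommGroup (Ec K k)] [∀ K k, NormedSpace ℂ (Ec K k)]
    (ι : (K k : ℕ) → (domSys (F.P K) M (k + 1)).Dom → ((Fin (F.P K).d → Site (F.P K) (k + 1) → V) →L[ℝ] Ec K k))
    {Dt : Set ℂ} (hDt : IsOpen Dt)
    (ℋ : (K k : ℕ) → (ℕ → ℝ) → ℕ → (domSys (F.P K) M (k + 1)).Dom → (domSys (F.P K) M (k + 1)).Dom → ℂ × Ec K k → ℂ)
    (hℋ : ∀ (K k : ℕ), ∀ h ∈ Window γ, ∀ (m : ℕ) (X Z : (domSys (F.P K) M (k + 1)).Dom), Z.1 ⊆ X.1 →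
      DifferentiableOn ℂ (ℋ K k h m X Z) (Dt ×ˢ ball (0 : Ec K k) R))
    (hMℋ : ∀ (K k : ℕ), ∀ h ∈ Window γ, ∀ (m : ℕ) (X Z : (domSys (F.P K) M (k + 1)).Dom), Z.1 ⊆ X.1 → ∀ p ∈ Dt ×ˢ ball (0 : Ec K k) R,
      ‖ℋ K k h m X Z p‖ ≤ A * Real.exp (-(Ra * (domSys (F.P K) M (k + 1)).dj Z)))
    (hfℋ : ∀ (K k : ℕ), ∀ h ∈ Window γ, ∀ (m : ℕ) (X Z : (domSys (F.P K) M (k + 1)).Dom), Z.1 ⊆ X.1 → ∀ t ∈ Ioc (0 : ℝ) γ,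
      ∀ Bf : Fin (F.P K).d → Site (F.P K) (k + 1) → V,
        ℋ K k h m X Z (t, ι K k X Bf) = ((S K) k).H (histPrefix (Function.update h m t) k) (emb K k (fun l s => NormedSpace.exp (ρ (Bf l s)))) Z) :
    (∀ (K k : ℕ), ∀ h ∈ Window γ, ∀ (m : ℕ) (X : (domSys (F.P K) M (k + 1)).Dom),
      DifferentiableOn ℂ (fun p : ℂ × Ec K k => locE (TTouch (d := 4) (N := domCount (F.P K) M (k + 1))) (fun Z : (domSys (F.P K) M (k + 1)).Dom => Z.1)
        (fun Z => ℋ K k h m X Z p) X.1) (Dt ×ˢ ball (0 : Ec K k) R)) ∧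
    (∀ (K k : ℕ), ∀ h ∈ Window γ, ∀ (m : ℕ) (X : (domSys (F.P K) M (k + 1)).Dom), ∀ p ∈ Dt ×ˢ ball (0 : Ec K k) R,
      ‖locE (TTouch (d := 4) (N := domCount (F.P K) M (k + 1))) (fun Z : (domSys (F.P K) M (k + 1)).Dom => Z.1) (fun Z => ℋ K k h m X Z p) X.1‖ ≤
        (Real.exp 1 * 9 * 64 * K₀ 64 8 ^ 2 * A) * Real.exp (-(r₁ * (domSys (F.P K) M (k + 1)).dj X))) ∧
    (∀ (K k : ℕ), ∀ h ∈ Window γ, ∀ (m : ℕ) (X : (domSys (F.P K) M (k + 1)).Dom), ∀ t ∈ Ioc (0 : ℝ) γ,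
      ∀ Bf : Fin (F.P K).d → Site (F.P K) (k + 1) → V,
        locE (TTouch (d := 4) (N := domCount (F.P K) M (k + 1))) (fun Z : (domSys (F.P K) M (k + 1)).Dom => Z.1)
            (fun Z => ℋ K k h m X Z ((t : ℂ), ι K k X Bf)) X.1 =
          ((S K) k).E (histPrefix (Function.update h m t) k) (emb K k (fun l s => NormedSpace.exp (ρ (Bf l s)))) X) := by
  have h1 := fun (K k : ℕ) (h : ℕ → ℝ) (hh : h ∈ Window γ) (m : ℕ) (X : (domSys (F.P K) M (k + 1)).Dom) =>
    outputChart_of_activityCharts F K ((S K) k) (hDt.prod isOpen_ball) hA hr₁ hrate hsmall X (ℋ K k h m X) (fun Z hZ => hℋ K k h hh m X Z hZ)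
      (fun p hp Z hZ => hMℋ K k h hh m X Z hZ p hp)
  refine ⟨fun K k h hh m X => (h1 K k h hh m X).1, fun K k h hh m X p hp => ((h1 K k h hh m X).2.1 p hp).trans_eq (by ring), fun K k h hh m X t ht Bf => ?_⟩
  exact (h1 K k h hh m X).2.2 _ _ _ fun Z hZ => hfℋ K k h hh m X Z hZ t ht Bf

end Tower

/-! ## §3 AT THE RECORD on the analytic road, from ACTIVITY-level joint charts: C4 §3 with its chart datum produced by §2 -/

section Record

variable (F : T4Family) (N : ℕ) [NeZero N] {𝔸 : Type*} {M : ℕ}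

open Classical in
/-- ★★★ **K3 §2b's `h9` WITH THE RECORD's GEOMETRIC MODULI ON THE ANALYTIC ROAD, FROM ACTIVITY-LEVEL JOINT (coupling, field) CHARTS.**  At a Stage-13 tuple `θ` (`0 < θ.γ`)
and a letter block `ℓ` with its signs: node N18's `KernelStepRateOfRecord₁₃ F N θ κ₅ ℓ.θ₅ C₅`, the uniform kernel decay (`E₀ > 0`), (1.21) existence, W1-20's law for towers
`S` read through `emb`; ACTIVITY-level joint charts `ℋ K k h m X Z : ℂ × Ec K k → ℂ` (`Z ⊆ X`) holomorphic on `Dt × ball(0, R)` (`Dt` open, containing the closed `r₀`-discs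
about `]0, θ.γ]`) with (2.38) `‖ℋ‖ ≤ A·e^{−Ra d_{k+1}(Z)}` there and agreeing at `(t, ι K k X B)` with `H(Z; (h|h_m:=t)_{≤k}; emb(exp θ.ρ8 B))`; Road 1's numerals; the terms
REAL at real data; probe readings `ι` with site weights `w` and (5.10)-type tails; rows `δ₁ ≤ κ₅`, `δ₁ ≤ κd`, `κ ≤ r₁`, `2κ₀(64,8) ≤ κ`, `0 < s < 1`, `ℓ.θ₅^{1−s} ≤ ℓ.ω`,
`ℓ.κ ≤ δ₁`, `C₉(s) ≤ ℓ.C₉` with the letter `B := e·9·64·K₀(64,8)²·A` ⟹ **`NE9 ((objectsOfRecord₁₃ F N θ ℓ).EA 0) (Window θ.γ) ℓ.κ ℓ.moduli`** — §2 then C4 §3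
`ne9_EA_objectsOfRecord₁₃_of_kernelStepRate_jointCharts`.  THE N22 ROW SENTENCE, analytic road, activity currency: «N18's kernel step rate + uniform decay + (1.21) + W1-20's
law + ACTIVITY-level joint (young coupling, field) charts with (2.38) + Road 1's numerals + reality + tails + rows ⇒ `h9` with the record's geometric moduli».  LOCATED
(hypothesis form); N22 NOT discharged. [folklore] -/
theorem ne9_EA_objectsOfRecord₁₃_of_kernelStepRate_activityJointCharts (θ : Stage13Params F N) (ℓ : U3Letters₁₁) (hs : ℓ.Signs) (hγ : 0 < θ.γ)
    (hlim : PolLimitsExistOfRecord₁₃ F N θ) {κ₅ κd C₅ E₀ : ℝ} (hC₅ : 0 ≤ C₅) (hE₀ : 0 < E₀)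
    (h5 : KernelStepRateOfRecord₁₃ F N θ κ₅ ℓ.θ₅ C₅) (hdec : DecayBound ((objectsOfRecord₁₃ F N θ ℓ).EA 0) (Window θ.γ) E₀ κd)
    (m' : ℕ) (M : ℕ) [NeZero M] (hM : M = F.L ^ m')
    (S : (K : ℕ) → ClusterTower (F.P K) 𝔸 M) (emb : ReadingMaps F (MatA N) 𝔸) (hloc : Localizes17OfRecord₁₃ F N θ S emb)
    {κ δ₀ B₃ R r₀ s A Ra r₁ : ℝ} (hR : 0 < R) (hκ₀ : kappa₀ (4 * 2 ^ 4) (2 * 4) ≤ κ / 2) (hδ₀ : 0 < δ₀) (hB₃ : 0 ≤ B₃)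
    (hA : 0 ≤ A) (hr₁ : 0 ≤ r₁) (hrate : r₁ + 2 * (64 * Real.log 162) + 2 ≤ Ra) (hsmall : A * Real.exp (5 * r₁ + 1) * K₀ 64 8 * 9 * 64 ≤ 1) (hκE : κ ≤ r₁)
    (hr₀ : 0 < r₀) (hs0 : 0 < s) (hs1 : s < 1)
    (Ec : ℕ → ℕ → Type*) [∀ K k, NormedAddCommGroup (Ec K k)] [∀ K k, NormedSpace ℂ (Ec K k)]
    (ι : letI := θ.instVβ₁; letI := θ.instVβ₂
      (K k : ℕ) → (domSys (F.P K) M (k + 1)).Dom → ((Fin (F.P K).d → Site (F.P K) (k + 1) → θ.Vβ) →L[ℝ] Ec K k))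
    {Dt : Set ℂ} (hDt : IsOpen Dt) (hdisc : ∀ t ∈ Ioc (0 : ℝ) θ.γ, closedBall (t : ℂ) r₀ ⊆ Dt)
    (ℋ : (K k : ℕ) → (ℕ → ℝ) → ℕ → (domSys (F.P K) M (k + 1)).Dom → (domSys (F.P K) M (k + 1)).Dom → ℂ × Ec K k → ℂ)
    (hℋ : ∀ (K k : ℕ), ∀ h ∈ Window θ.γ, ∀ (m : ℕ) (X Z : (domSys (F.P K) M (k + 1)).Dom), Z.1 ⊆ X.1 →
      DifferentiableOn ℂ (ℋ K k h m X Z) (Dt ×ˢ ball (0 : Ec K k) R))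
    (hMℋ : ∀ (K k : ℕ), ∀ h ∈ Window θ.γ, ∀ (m : ℕ) (X Z : (domSys (F.P K) M (k + 1)).Dom), Z.1 ⊆ X.1 → ∀ p ∈ Dt ×ˢ ball (0 : Ec K k) R,
      ‖ℋ K k h m X Z p‖ ≤ A * Real.exp (-(Ra * (domSys (F.P K) M (k + 1)).dj Z)))
    (hfℋ : letI := θ.instVβ₁; letI := θ.instVβ₂
      ∀ (K k : ℕ), ∀ h ∈ Window θ.γ, ∀ (m : ℕ) (X Z : (domSys (F.P K) M (k + 1)).Dom), Z.1 ⊆ X.1 → ∀ t ∈ Ioc (0 : ℝ) θ.γ,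
        ∀ Bf : Fin (F.P K).d → Site (F.P K) (k + 1) → θ.Vβ,
          ℋ K k h m X Z (t, ι K k X Bf) = ((S K) k).H (histPrefix (Function.update h m t) k) (emb K k (fun l u => NormedSpace.exp (θ.ρ8 (Bf l u)))) Z)
    (hIm : letI := θ.instVβ₁; letI := θ.instVβ₂
      ∀ (K k : ℕ), ∀ h ∈ Window θ.γ, ∀ (m : ℕ) (X : (domSys (F.P K) M (k + 1)).Dom), ∀ t ∈ Ioc (0 : ℝ) θ.γ,
        ∀ Bf : Fin (F.P K).d → Site (F.P K) (k + 1) → θ.Vβ,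
          (((S K) k).E (histPrefix (Function.update h m t) k) (emb K k (fun l u => NormedSpace.exp (θ.ρ8 (Bf l u)))) X).im = 0)
    (w : (K k : ℕ) → (domSys (F.P K) M (k + 1)).Dom → Site (F.P K) (k + 1) → ℝ) (hw₀ : ∀ K k X t, 0 ≤ w K k X t)
    (hw : letI := θ.instVβ₁; letI := θ.instVβ₂; letI := θ.instιβ
      ∀ (K k : ℕ) (X : (domSys (F.P K) M (k + 1)).Dom) (l : Fin (F.P K).d) (t : Site (F.P K) (k + 1)) (c : θ.ιβ),
        ‖ι K k X (Pi.single l (Pi.single t (θ.bV c)))‖ ≤ w K k X t)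
    (htail : ∀ (K k : ℕ) (X : (domSys (F.P K) M (k + 1)).Dom) (t : Site (F.P K) (k + 1)),
      let e : Site (F.P K) (k + 1) → TPt 4 (domCount (F.P K) M (k + 1) * M) := fun x i => (ZMod.cast (x i) : ZMod (domCount (F.P K) M (k + 1) * M))
      w K k X t ≤ B₃ * Real.exp (-δ₀ * distCT (domCount (F.P K) M (k + 1)) M (e t) (nearT (M := M) (e t) X)))
    (hκ₅ : delta1 δ₀ κ ((M : ℝ) * 4) ≤ κ₅) (hκd : delta1 δ₀ κ ((M : ℝ) * 4) ≤ κd)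
    (hτω : ℓ.θ₅ ^ (1 - s) ≤ ℓ.ω) (hℓκ : ℓ.κ ≤ delta1 δ₀ κ ((M : ℝ) * 4))
    (hC₉ : 32 / (s ^ 2 * min (r₀ / 2) (θ.γ / 2)) * ((2 * (2 * C₅ / (1 - ℓ.θ₅) + 2 * E₀)) ^ (1 - s) *
        (2 * ((16 * (Real.exp 1 * 9 * 64 * K₀ 64 8 ^ 2 * A) * B₃ ^ 2 / R ^ 2) * Real.exp (delta1 δ₀ κ ((M : ℝ) * 4) * ((M : ℝ) * 4) * 3) * K₀ (4 * 2 ^ 4) (2 * 4) * K₁ 4 (δ₀ / 2) +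
          (2 * C₅ / (1 - ℓ.θ₅) + 2 * E₀))) ^ s) / ℓ.θ₅ ^ (1 - s) ≤ ℓ.C₉) :
    NE9 ((objectsOfRecord₁₃ F N θ ℓ).EA 0) (Window θ.γ) ℓ.κ ℓ.moduli := by
  letI := θ.instVβ₁; letI := θ.instVβ₂; letI := θ.instιβ
  have hB : (0 : ℝ) ≤ Real.exp 1 * 9 * 64 * K₀ 64 8 ^ 2 * A := by have := K₀_pos 64 8; positivity
  obtain ⟨h𝒢, hM𝒢, hf⟩ := jointCharts_of_activityJointCharts F S emb θ.ρ8 hA hr₁ hrate hsmall Ec ι hDt ℋ hℋ hMℋ hfℋ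
  exact ne9_EA_objectsOfRecord₁₃_of_kernelStepRate_jointCharts F N θ ℓ hs hγ hlim hC₅ hE₀ h5 hdec m' M hM S emb hloc hR hκ₀ hδ₀ hB₃ hB hκE hr₀ hs0 hs1 Ec ι hDt hdisc
    (fun K k h m X p => locE (TTouch (d := 4) (N := domCount (F.P K) M (k + 1))) (fun Z : (domSys (F.P K) M (k + 1)).Dom => Z.1) (fun Z => ℋ K k h m X Z p) X.1)
    h𝒢 hM𝒢 hf hIm w hw₀ hw htail hκ₅ hκd hτω hℓκ hC₉

open Classical in
/-- ★★★ **PIN FACE of §3 — THE N22 ROW OF K3⁸ ON THE ANALYTIC ROAD FROM ACTIVITY-LEVEL JOINT CHARTS.**  At a Stage-13H tuple `θ` with provisos `hP`, a rate reading `𝔯` PINNED to the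
kernel objects of record (`hpin`), and §3's inputs at `θ.toStage13Params` ⟹ **`N22At (rateCarriersOfRecord₁₃CoPH 𝔯 F θ hP g₀ os k).u3`** for every `k` — §3 composed with
dag-n22-w5's `n22At_rateCarriers_of_kernels_pin_of_ne9`.  LOCATED (hypothesis form); N22 NOT discharged; nothing of [I]∕[II] asserted. [folklore] -/
theorem n22At_rateCarriers_of_kernels_pin_of_kernelStepRate_activityJointCharts (𝔯 : RateReading₁₃CoPH N) (θ : Stage13HParams F N) (hP : θ.Provisos₁₃CoPH F N)
    (g₀ : ℕ → ℝ) (os : List (ULoop F)) (ℓ : U3Letters₁₁) (hs : ℓ.Signs) (hγ : 0 < θ.γ)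
    (hpin : (𝔯.lit F θ hP g₀ os).u3 = objectsOfRecord₁₃ F N θ.toStage13Params ℓ)
    (hlim : PolLimitsExistOfRecord₁₃ F N θ.toStage13Params) {κ₅ κd C₅ E₀ : ℝ} (hC₅ : 0 ≤ C₅) (hE₀ : 0 < E₀)
    (h5 : KernelStepRateOfRecord₁₃ F N θ.toStage13Params κ₅ ℓ.θ₅ C₅) (hdec : DecayBound ((objectsOfRecord₁₃ F N θ.toStage13Params ℓ).EA 0) (Window θ.γ) E₀ κd)
    (m' : ℕ) (M : ℕ) [NeZero M] (hM : M = F.L ^ m')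
    (S : (K : ℕ) → ClusterTower (F.P K) 𝔸 M) (emb : ReadingMaps F (MatA N) 𝔸) (hloc : Localizes17OfRecord₁₃ F N θ.toStage13Params S emb)
    {κ δ₀ B₃ R r₀ s A Ra r₁ : ℝ} (hR : 0 < R) (hκ₀ : kappa₀ (4 * 2 ^ 4) (2 * 4) ≤ κ / 2) (hδ₀ : 0 < δ₀) (hB₃ : 0 ≤ B₃)
    (hA : 0 ≤ A) (hr₁ : 0 ≤ r₁) (hrate : r₁ + 2 * (64 * Real.log 162) + 2 ≤ Ra) (hsmall : A * Real.exp (5 * r₁ + 1) * K₀ 64 8 * 9 * 64 ≤ 1) (hκE : κ ≤ r₁)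
    (hr₀ : 0 < r₀) (hs0 : 0 < s) (hs1 : s < 1)
    (Ec : ℕ → ℕ → Type*) [∀ K k, NormedAddCommGroup (Ec K k)] [∀ K k, NormedSpace ℂ (Ec K k)]
    (ι : letI := θ.instVβ₁; letI := θ.instVβ₂
      (K k : ℕ) → (domSys (F.P K) M (k + 1)).Dom → ((Fin (F.P K).d → Site (F.P K) (k + 1) → θ.Vβ) →L[ℝ] Ec K k))
    {Dt : Set ℂ} (hDt : IsOpen Dt) (hdisc : ∀ t ∈ Ioc (0 : ℝ) θ.γ, closedBall (t : ℂ) r₀ ⊆ Dt)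
    (ℋ : (K k : ℕ) → (ℕ → ℝ) → ℕ → (domSys (F.P K) M (k + 1)).Dom → (domSys (F.P K) M (k + 1)).Dom → ℂ × Ec K k → ℂ)
    (hℋ : ∀ (K k : ℕ), ∀ h ∈ Window θ.γ, ∀ (m : ℕ) (X Z : (domSys (F.P K) M (k + 1)).Dom), Z.1 ⊆ X.1 →
      DifferentiableOn ℂ (ℋ K k h m X Z) (Dt ×ˢ ball (0 : Ec K k) R))
    (hMℋ : ∀ (K k : ℕ), ∀ h ∈ Window θ.γ, ∀ (m : ℕ) (X Z : (domSys (F.P K) M (k + 1)).Dom), Z.1 ⊆ X.1 → ∀ p ∈ Dt ×ˢ ball (0 : Ec K k) R,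
      ‖ℋ K k h m X Z p‖ ≤ A * Real.exp (-(Ra * (domSys (F.P K) M (k + 1)).dj Z)))
    (hfℋ : letI := θ.instVβ₁; letI := θ.instVβ₂
      ∀ (K k : ℕ), ∀ h ∈ Window θ.γ, ∀ (m : ℕ) (X Z : (domSys (F.P K) M (k + 1)).Dom), Z.1 ⊆ X.1 → ∀ t ∈ Ioc (0 : ℝ) θ.γ,
        ∀ Bf : Fin (F.P K).d → Site (F.P K) (k + 1) → θ.Vβ,
          ℋ K k h m X Z (t, ι K k X Bf) = ((S K) k).H (histPrefix (Function.update h m t) k) (emb K k (fun l u => NormedSpace.exp (θ.ρ8 (Bf l u)))) Z)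
    (hIm : letI := θ.instVβ₁; letI := θ.instVβ₂
      ∀ (K k : ℕ), ∀ h ∈ Window θ.γ, ∀ (m : ℕ) (X : (domSys (F.P K) M (k + 1)).Dom), ∀ t ∈ Ioc (0 : ℝ) θ.γ,
        ∀ Bf : Fin (F.P K).d → Site (F.P K) (k + 1) → θ.Vβ,
          (((S K) k).E (histPrefix (Function.update h m t) k) (emb K k (fun l u => NormedSpace.exp (θ.ρ8 (Bf l u)))) X).im = 0)
    (w : (K k : ℕ) → (domSys (F.P K) M (k + 1)).Dom → Site (F.P K) (k + 1) → ℝ) (hw₀ : ∀ K k X t, 0 ≤ w K k X t)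
    (hw : letI := θ.instVβ₁; letI := θ.instVβ₂; letI := θ.instιβ
      ∀ (K k : ℕ) (X : (domSys (F.P K) M (k + 1)).Dom) (l : Fin (F.P K).d) (t : Site (F.P K) (k + 1)) (c : θ.ιβ),
        ‖ι K k X (Pi.single l (Pi.single t (θ.bV c)))‖ ≤ w K k X t)
    (htail : ∀ (K k : ℕ) (X : (domSys (F.P K) M (k + 1)).Dom) (t : Site (F.P K) (k + 1)),
      let e : Site (F.P K) (k + 1) → TPt 4 (domCount (F.P K) M (k + 1) * M) := fun x i => (ZMod.cast (x i) : ZMod (domCount (F.P K) M (k + 1) * M))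
      w K k X t ≤ B₃ * Real.exp (-δ₀ * distCT (domCount (F.P K) M (k + 1)) M (e t) (nearT (M := M) (e t) X)))
    (hκ₅ : delta1 δ₀ κ ((M : ℝ) * 4) ≤ κ₅) (hκd : delta1 δ₀ κ ((M : ℝ) * 4) ≤ κd)
    (hτω : ℓ.θ₅ ^ (1 - s) ≤ ℓ.ω) (hℓκ : ℓ.κ ≤ delta1 δ₀ κ ((M : ℝ) * 4))
    (hC₉ : 32 / (s ^ 2 * min (r₀ / 2) (θ.γ / 2)) * ((2 * (2 * C₅ / (1 - ℓ.θ₅) + 2 * E₀)) ^ (1 - s) *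
        (2 * ((16 * (Real.exp 1 * 9 * 64 * K₀ 64 8 ^ 2 * A) * B₃ ^ 2 / R ^ 2) * Real.exp (delta1 δ₀ κ ((M : ℝ) * 4) * ((M : ℝ) * 4) * 3) * K₀ (4 * 2 ^ 4) (2 * 4) * K₁ 4 (δ₀ / 2) +
          (2 * C₅ / (1 - ℓ.θ₅) + 2 * E₀))) ^ s) / ℓ.θ₅ ^ (1 - s) ≤ ℓ.C₉)
    (k : ℕ) :
    N22At (rateCarriersOfRecord₁₃CoPH 𝔯 F θ hP g₀ os k).u3 :=
  n22At_rateCarriers_of_kernels_pin_of_ne9 𝔯 θ hP g₀ os ℓ hs hpin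
    (ne9_EA_objectsOfRecord₁₃_of_kernelStepRate_activityJointCharts F N θ.toStage13Params ℓ hs hγ hlim hC₅ hE₀ h5 hdec m' M hM S emb hloc hR hκ₀ hδ₀ hB₃ hA hr₁ hrate hsmall
      hκE hr₀ hs0 hs1 Ec ι hDt hdisc ℋ hℋ hMℋ hfℋ hIm w hw₀ hw htail hκ₅ hκd hτω hℓκ hC₉) k

end Record

end YMDAG.N22.JointHoloLocalTerms

end
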